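import Summits.Schanuel.Schanuel.Theorems.RoyCriterionNguyenRoySmallValueTranslatesStubConcentratedCloses
import Summits.Schanuel.Schanuel.Theorems.RoyCriterionNguyenRoySmallValueTranslatesStubDegLowerBound
import Summits.Schanuel.Schanuel.Theorems.RoyCriterionNguyenRoySmallValueTranslatesStubCase2Free
import Summits.Schanuel.Schanuel.Theorems.RoyCriterionNguyenRoySmallValueTranslatesStubExponents
import HarnessLib

/-!
# Route `RoyCriterion`, crux `NguyenRoySmallValueTranslates` (stmt-Schanuel-1051), line `Sketch`
# — stub `stub_abstractSharp` (the lead's integration stub)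

Registered stub E of the skeleton of line `Sketch` for the crux
`Summit.Schanuel.Schanuel.Theses.RoyCriterion.NguyenRoySmallValueTranslates`: **§6 of Nguyen–Roy
2016, sharpened, in abstract form** — an `NguyenRoy.EndgameData σ β ν` whose classes are aperiodic
(`hnoper`: no point of a class with at least two points has a non-zero translate in the class)
cannot exist for `1 < σ < 3/2`, `β > σ + 1` and `ν > 2 + β − σ + (σ−1)(3−2σ)/(1+2β−σ)` (the
printed threshold has `2+β−2σ` in the denominator).

Proof (composition of the four abstract stubs, all landed): by stub A (`stub_concentratedCloses`)
no large level is concentrated; at a non-concentrated level Corollary 16 and stub B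
(`stub_degLowerBound`) give `deg(Z_D)² ≥ (κ/8) D^{ν+σ−1−β}` (`ncBound_eventually`); the auxiliary
level `D*` of (6.1) for the good translate `Z̃_D` of Proposition 17 is in the regime of the printed
proof (`regime`, copied from `EndgameData.false_of_constraints`), where stub C (`stub_case2Free`)
gives `(κ/16)(D*)^σ D^{ν−2} deg ≤ D* h(Z̃_D) ≤ 2B₁₄ (D*)^{2+β−σ}` and `(D*)^{σ−1} ≤ (8/κ)D^{1+β−ν}`;
stub D (`stub_exponents`) shows these three inequalities are incompatible for `D` large. No Case 1
is needed: the non-concentration degree bound replaces the Case-2 hypothesis of the printed proof.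

## References

* [NguyenRoy2016] N. A. V. Nguyen, D. Roy, IJNT 12 (2016) 1273–1293 = arXiv:1412.5163, §6,
  Propositions 14, 17, Corollary 16.
-/

-- `Summit.Schanuel.Schanuel.…` is the mandated layout of this single-problem summit (CONVENTIONS §1).
set_option linter.dupNamespace false

noncomputable section

open Filter Finset
open scoped Classical

namespace Summit.Schanuel.Schanuel.Theorems.NguyenRoySharp

open Literature.NumberTheory.Transcendental
open Literature.NumberTheory.Transcendental.NguyenRoy

/-- **Numerics turning stub B's inequality into the non-concentration degree bound.** For `D`
large and every `c ≥ 1`, `h ≥ 0`: if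
`κ D^{ν−β+σ−2}(2D^β c + D h) < 2c (c₁₂ c² + 2 c h + 2c₄ ⌊D^σ⌋ c² + c₁ ⌊D^σ⌋ + log 4)` then
`(κ/8) D^{ν+σ−1−β} ≤ c²` (otherwise the right side is at most the left side, the four lower-order
terms being `≤ κ D^{ν+σ−2}` in total since `ν + σ − 2 > σ + (ν+σ−1−β), σ, 0`, i.e. `β > σ + 1`,
`ν > 2`). [cite: NguyenRoy2016, §6 (exponent bookkeeping); folklore] -/
theorem ncBound_eventually {σ β ν κ c₁₂ c₄ c₁ : ℝ} (hκ : 0 < κ) (hc₁₂ : 0 ≤ c₁₂) (hc₄ : 0 ≤ c₄)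
    (hc₁ : 0 ≤ c₁) (hσ0 : 0 ≤ σ) (hβ : σ + 1 < β) (hν : 2 + β - σ < ν) :
    ∀ᶠ D : ℕ in atTop, ∀ c h : ℝ, 1 ≤ c → 0 ≤ h →
      κ * (D : ℝ) ^ (ν - β + σ - 2) * (2 * (D : ℝ) ^ β * c + D * h) <
        2 * c * (c₁₂ * c ^ 2 + 2 * c * h + 2 * c₄ * ⌊(D : ℝ) ^ σ⌋₊ * c ^ 2 + c₁ * ⌊(D : ℝ) ^ σ⌋₊ +
          Real.log 4) →
      κ / 8 * (D : ℝ) ^ (ν + σ - 1 - β) ≤ c ^ 2 := by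
  have e1 := EndgameData.eventually_mul_rpow_le_rpow (c₁₂ / 2) (a := ν + σ - 1 - β)
    (b := ν + σ - 2) (by linarith)
  have e2 := EndgameData.eventually_mul_rpow_le_rpow c₄ (a := σ + (ν + σ - 1 - β))
    (b := ν + σ - 2) (by linarith)
  have e3 := EndgameData.eventually_mul_rpow_le_rpow (4 * c₁ / κ) (a := σ) (b := ν + σ - 2)
    (by linarith)
  have e4 := EndgameData.eventually_mul_rpow_le_rpow (4 * Real.log 4 / κ) (a := 0)
    (b := ν + σ - 2) (by linarith)
  filter_upwards [e1, e2, e3, e4, eventually_ge_atTop 1] with D h1 h2 h3 h4 hD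
  intro c h hc1 hh0 hlt
  have hDpos : (0 : ℝ) < D := by exact_mod_cast hD
  rw [Real.rpow_zero, mul_one] at h4
  set P : ℝ := (D : ℝ) ^ (ν - β + σ - 2) with hP
  set Q : ℝ := κ / 8 * (D : ℝ) ^ (ν + σ - 1 - β) with hQ
  set T : ℝ := (⌊(D : ℝ) ^ σ⌋₊ : ℝ) with hT
  have hPpos : 0 < P := Real.rpow_pos_of_pos hDpos _
  have hQpos : 0 < Q := by positivity
  have hTσ : T ≤ (D : ℝ) ^ σ := Nat.floor_le (by positivity)
  have hT0 : 0 ≤ T := by positivity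
  have hc0 : 0 ≤ c := by linarith
  -- `Q = (κ/8) P D` and `P D^β = D^{ν+σ-2}`
  have hQ' : Q = κ / 8 * (P * D) := by
    rw [hQ, hP, show ν + σ - 1 - β = (ν - β + σ - 2) + 1 by ring, Real.rpow_add hDpos,
      Real.rpow_one]
  have hPβ : P * (D : ℝ) ^ β = (D : ℝ) ^ (ν + σ - 2) := by
    rw [hP, ← Real.rpow_add hDpos]; ring_nf
  have hσQ : (D : ℝ) ^ σ * (D : ℝ) ^ (ν + σ - 1 - β) = (D : ℝ) ^ (σ + (ν + σ - 1 - β)) := by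
    rw [← Real.rpow_add hDpos]
  by_contra hcon
  push Not at hcon
  -- the four lower-order terms
  have hX : 0 < (D : ℝ) ^ (ν + σ - 2) := Real.rpow_pos_of_pos hDpos _
  have t1 : c₁₂ * Q ≤ κ / 4 * (D : ℝ) ^ (ν + σ - 2) := by
    have : c₁₂ * Q = κ / 4 * (c₁₂ / 2 * (D : ℝ) ^ (ν + σ - 1 - β)) := by rw [hQ]; ring
    rw [this]
    exact mul_le_mul_of_nonneg_left h1 (by positivity)
  have t2 : 2 * c₄ * (D : ℝ) ^ σ * Q ≤ κ / 4 * (D : ℝ) ^ (ν + σ - 2) := by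
    have : 2 * c₄ * (D : ℝ) ^ σ * Q = κ / 4 * (c₄ * (D : ℝ) ^ (σ + (ν + σ - 1 - β))) := by
      rw [hQ, ← hσQ]; ring
    rw [this]
    exact mul_le_mul_of_nonneg_left h2 (by positivity)
  have t3 : c₁ * (D : ℝ) ^ σ ≤ κ / 4 * (D : ℝ) ^ (ν + σ - 2) := by
    have h3' : 4 * c₁ / κ * (D : ℝ) ^ σ * κ ≤ (D : ℝ) ^ (ν + σ - 2) * κ :=
      mul_le_mul_of_nonneg_right h3 hκ.le
    have : 4 * c₁ / κ * (D : ℝ) ^ σ * κ = 4 * (c₁ * (D : ℝ) ^ σ) := by field_simp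
    rw [this] at h3'
    linarith
  have t4 : Real.log 4 ≤ κ / 4 * (D : ℝ) ^ (ν + σ - 2) := by
    have h4' : 4 * Real.log 4 / κ * κ ≤ (D : ℝ) ^ (ν + σ - 2) * κ :=
      mul_le_mul_of_nonneg_right h4 hκ.le
    have : 4 * Real.log 4 / κ * κ = 4 * Real.log 4 := by field_simp
    rw [this] at h4'
    linarith
  -- bound the bracket using `c² < Q`, `T ≤ D^σ`
  have hc2Q : c ^ 2 ≤ Q := hcon.le
  have b1 : c₁₂ * c ^ 2 ≤ c₁₂ * Q := mul_le_mul_of_nonneg_left hc2Q hc₁₂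
  have b2 : 2 * c₄ * T * c ^ 2 ≤ 2 * c₄ * (D : ℝ) ^ σ * Q :=
    mul_le_mul (mul_le_mul_of_nonneg_left hTσ (by positivity)) hc2Q (by positivity)
      (by positivity)
  have b3 : c₁ * T ≤ c₁ * (D : ℝ) ^ σ := mul_le_mul_of_nonneg_left hTσ hc₁
  have hbr : c₁₂ * c ^ 2 + 2 * c₄ * T * c ^ 2 + c₁ * T + Real.log 4 ≤
      κ * (D : ℝ) ^ (ν + σ - 2) := by linarith
  -- the height term
  have b4 : 4 * c ^ 2 * h ≤ κ * P * D * h := by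
    have i1 : 4 * c ^ 2 * h ≤ 4 * Q * h := by
      have := mul_le_mul_of_nonneg_right hc2Q hh0
      linarith
    have i2 : 4 * Q * h ≤ κ * P * D * h := by
      rw [hQ']
      have : 0 ≤ κ * (P * D) * h := by positivity
      nlinarith
    linarith
  -- assemble: RHS ≤ LHS
  have hR : 2 * c * (c₁₂ * c ^ 2 + 2 * c * h + 2 * c₄ * T * c ^ 2 + c₁ * T + Real.log 4) =
      4 * c ^ 2 * h + 2 * c * (c₁₂ * c ^ 2 + 2 * c₄ * T * c ^ 2 + c₁ * T + Real.log 4) := by ring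
  have hbr' : 2 * c * (c₁₂ * c ^ 2 + 2 * c₄ * T * c ^ 2 + c₁ * T + Real.log 4) ≤
      2 * c * (κ * (D : ℝ) ^ (ν + σ - 2)) := mul_le_mul_of_nonneg_left hbr (by positivity)
  have hL : κ * P * (2 * (D : ℝ) ^ β * c + D * h) =
      κ * P * D * h + 2 * c * (κ * (D : ℝ) ^ (ν + σ - 2)) := by rw [← hPβ]; ring
  have : 2 * c * (c₁₂ * c ^ 2 + 2 * c * h + 2 * c₄ * T * c ^ 2 + c₁ * T + Real.log 4) ≤
      κ * P * (2 * (D : ℝ) ^ β * c + D * h) := by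
    rw [hR, hL]; linarith
  exact absurd hlt (not_lt.mpr this)

section AbstractSharp

variable {σ β ν : ℝ} (E : EndgameData σ β ν)

include E in
/-- **Integration stub (lead) — §6 sharpened, abstract form: an `EndgameData σ β ν` whose classes
are aperiodic (`hnoper`) cannot exist for `1 < σ < 3/2`, `β > σ+1`,
`ν > 2+β−σ+(σ−1)(3−2σ)/(1+2β−σ)`.** Composition of stubs A–D with the tree's Proposition 17 and
the regime of the auxiliary level `D*` ((6.1)–(6.3)): no large level is concentrated (stub A); at
every large level Corollary 16 + stub B give `deg² ≥ (κ/8) D^{ν+σ−1−β}`, stub C gives the free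
Case-2 inequality and (II), and stub D derives the contradiction. [cite: NguyenRoy2016, §6] -/
theorem stub_abstractSharp
    (hnoper : ∀ Z : E.V, 2 ≤ (E.pts Z).card → ∀ a ∈ E.pts Z, ∀ k : ℤ, k ≠ 0 → E.τ k a ∉ E.pts Z)
    (hσ1 : 1 < σ) (hσ2 : σ < 3 / 2) (hβ : σ + 1 < β)
    (hν : 2 + β - σ + (σ - 1) * (3 - 2 * σ) / (1 + 2 * β - σ) < ν) : False := by
  classical
  have hcorr : 0 ≤ (σ - 1) * (3 - 2 * σ) / (1 + 2 * β - σ) :=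
    div_nonneg (mul_nonneg (by linarith) (by linarith)) (by linarith)
  have hν' : 2 + β - σ < ν := by linarith
  have hσ1' : 1 ≤ σ := hσ1.le
  have hν2' : 2 < ν := by linarith
  have hκ := E.κ_pos
  have hA0 : 0 < E.A₁₄ := by linarith [E.one_le_A₁₄]
  have hB0 : 0 < E.B₁₄ := by linarith [E.one_le_B₁₄]
  -- no large level is concentrated (stub A)
  have hnotconc : ∀ᶠ D : ℕ in atTop, ¬ ∃ ι : E.Pt → ℤ,
      (∀ a ∈ E.pts (E.Z D), 0 ≤ ι a ∧ ι a < (⌊(D : ℝ) ^ σ⌋₊ : ℕ)) ∧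
      ∃ a₀ ∈ E.pts (E.Z D),
        (D : ℝ) ^ β + Real.log (E.dist a₀ (E.γ (ι a₀))) ≤
          -(E.κ / 2 * (D : ℝ) ^ (ν - β + σ - 2) *
            (2 * (D : ℝ) ^ β * (E.pts (E.Z D)).card + D * E.ht (E.Z D))) := by
    by_contra hcon
    rw [Filter.not_eventually] at hcon
    exact stub_concentratedCloses E hσ1' hβ hν' (hcon.mono fun D hD => not_not.mp hD)
  obtain ⟨Nc, hNc⟩ := Filter.eventually_atTop.mp hnotconc
  -- the non-concentration numerics (for stub B)
  obtain ⟨NB, hNB⟩ := Filter.eventually_atTop.mp (ncBound_eventually (σ := σ) (β := β) (ν := ν)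
    E.κ_pos E.c₁₂_nonneg E.c₄_nonneg E.c₁_nonneg (by linarith) hβ hν')
  -- Proposition 17, in terms of `Z̃_D = E.zt mf D`
  obtain ⟨D₁, mf, h17⟩ := E.prop17' hσ1' hβ hν2'
  have h17' : ∀ D : ℕ, D₁ ≤ D → E.D₀ ≤ D ∧ mf D < ⌊(D : ℝ) ^ σ⌋₊ ∧
      ∀ n : ℕ, 1 ≤ n → n ≤ ⌊(D : ℝ) ^ σ⌋₊ →
        ∃ ι : E.Pt → ℤ, (∀ b ∈ E.pts (E.zt mf D), |ι b| < n) ∧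
          ∑ b ∈ E.pts (E.zt mf D), Real.log (E.dist b (E.γ (ι b))) ≤
            -(n * (E.κ / 4) * (D : ℝ) ^ (ν - β - 2) *
              ((D : ℝ) ^ β * (E.pts (E.zt mf D)).card + D * E.ht (E.zt mf D))) := h17
  -- divergence of `max(deg, ht)(Z̃_D)` (Corollary 19 + Proposition 12 + positivity)
  have hdiv : ∀ Bd : ℝ, ∀ᶠ D : ℕ in atTop,
      Bd < (E.pts (E.zt mf D)).card ∨ Bd < E.ht (E.zt mf D) := by
    intro Bd
    refine E.eventually_lt_card_or_lt_ht (E.zt mf)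
      (ε := fun D : ℕ => Real.exp (-((E.κ / 4) * (D : ℝ) ^ (ν - 2)))) ?_ ?_ Bd
    · have h1 : Tendsto (fun D : ℕ => (E.κ / 4) * (D : ℝ) ^ (ν - 2)) atTop atTop :=
        Tendsto.const_mul_atTop (by positivity)
          ((tendsto_rpow_atTop (by linarith)).comp tendsto_natCast_atTop_atTop)
      exact Real.tendsto_exp_neg_atTop_nhds_zero.comp h1
    · filter_upwards [eventually_ge_atTop (max D₁ 1)] with D hD
      obtain ⟨-, -, hP⟩ := h17' D (le_trans (le_max_left _ _) hD)
      have hD1 : 1 ≤ D := le_trans (le_max_right _ _) hD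
      have hDr : (1 : ℝ) ≤ D := by exact_mod_cast hD1
      have h1T : 1 ≤ ⌊(D : ℝ) ^ σ⌋₊ :=
        Nat.le_floor (by exact_mod_cast Real.one_le_rpow hDr (by linarith))
      obtain ⟨ι, hι, hs⟩ := hP 1 le_rfl h1T
      obtain ⟨b, hb, hle⟩ := E.exists_close_point hD1 hs
      have hι0 : ι b = 0 := by
        have := abs_lt.mp (hι b hb)
        omega
      refine ⟨b, hb, ?_⟩
      rw [hι0] at hle
      refine hle.trans (le_of_eq ?_)
      push_cast
      ring_nf
  -- thresholds
  obtain ⟨N₂, hN₂⟩ := Filter.eventually_atTop.mp (EndgameData.case2i_eventually (A := E.A₁₄)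
    (B := E.B₁₄) (ν := ν) E.c₇_nonneg E.c₄_nonneg hσ1' hβ hν')
  obtain ⟨N₃, hN₃⟩ := Filter.eventually_atTop.mp (EndgameData.case2ii_eventually (c₇ := E.c₇)
    (c₄ := E.c₄) E.κ_pos hσ1' hβ hν')
  obtain ⟨N₄, hN₄⟩ := Filter.eventually_atTop.mp (EndgameData.coeff_eventually (c₁ := E.c₁)
    hσ1' hβ)
  set N₅ : ℕ := ⌈(1 + β - σ) / Real.log 2⌉₊ with hN₅
  set N₀ : ℕ := D₁ + 1 + N₂ + N₃ + N₄ + N₅ with hN₀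
  -- (6.1) holds at level `N₀` for `D ≥ D₂`
  obtain ⟨D₂, hD₂⟩ := Filter.eventually_atTop.mp
    (hdiv (max (E.A₁₄ * (N₀ : ℝ) ^ (2 - σ)) (E.B₁₄ * (N₀ : ℝ) ^ (1 + β - σ))))
  -- the regime: for `D ≥ D₂ + N₀ + 1`, `d = D*` satisfies `N₀ ≤ d < D`, (6.1) and (6.3)
  have regime : ∀ D : ℕ, D₂ + N₀ + 1 ≤ D →
      N₀ ≤ E.dstar mf D ∧ E.dstar mf D < D ∧
      (E.A₁₄ * (E.dstar mf D : ℝ) ^ (2 - σ) < (E.pts (E.zt mf D)).card ∨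
        E.B₁₄ * (E.dstar mf D : ℝ) ^ (1 + β - σ) < E.ht (E.zt mf D)) ∧
      ((E.pts (E.zt mf D)).card : ℝ) ≤ 2 * E.A₁₄ * (E.dstar mf D : ℝ) ^ (2 - σ) ∧
      E.ht (E.zt mf D) ≤ 2 * E.B₁₄ * (E.dstar mf D : ℝ) ^ (1 + β - σ) := by
    -- adapted from Literature/NumberTheory/Transcendental/RoySmallValueEstimatesEndgameAssemblyProofs.lean,
    -- `EndgameData.false_of_constraints` (the block `regime`)
    intro D hD
    have h1' : N₀ ≤ D := by omega
    have hcritN₀ : E.A₁₄ * (N₀ : ℝ) ^ (2 - σ) < (E.pts (E.zt mf D)).card ∨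
        E.B₁₄ * (N₀ : ℝ) ^ (1 + β - σ) < E.ht (E.zt mf D) := by
      rcases hD₂ D (by omega) with h | h
      · exact Or.inl (lt_of_le_of_lt (le_max_left _ _) h)
      · exact Or.inr (lt_of_le_of_lt (le_max_right _ _) h)
    have h1 : N₀ ≤ E.dstar mf D := E.le_dstar mf h1' hcritN₀
    have h2 := E.dstar_spec mf h1' hcritN₀
    obtain ⟨hD0, hm, -⟩ := h17' D (by omega)
    have hself := E.bounds_self hD0 hm
    change ((E.pts (E.zt mf D)).card : ℝ) ≤ _ ∧ E.ht (E.zt mf D) ≤ _ at hself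
    have h3 : E.dstar mf D < D := by
      rcases (E.dstar_le mf D).lt_or_eq with h | h
      · exact h
      · exfalso
        rw [h] at h2
        rcases h2 with h2 | h2 <;> linarith [hself.1, hself.2]
    have h4 := E.not_crit_dstar_succ mf (show E.dstar mf D + 1 ≤ D by omega)
    push_cast at h4
    push Not at h4
    have hd1 : (1 : ℝ) ≤ E.dstar mf D := by exact_mod_cast (show 1 ≤ E.dstar mf D by omega)
    have hdN₅ : (1 + β - σ) / Real.log 2 ≤ (E.dstar mf D : ℝ) :=
      le_trans (Nat.le_ceil _) (by exact_mod_cast (show N₅ ≤ E.dstar mf D by omega))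
    have hlog2 : 0 < Real.log 2 := Real.log_pos (by norm_num)
    have e1 : ((E.dstar mf D : ℝ) + 1) ^ (2 - σ) ≤ 2 * (E.dstar mf D : ℝ) ^ (2 - σ) :=
      EndgameData.add_one_rpow_le_two_mul_rpow (by linarith) hd1
        (le_trans (div_le_div_of_nonneg_right (by linarith) hlog2.le) hdN₅)
    have e2 : ((E.dstar mf D : ℝ) + 1) ^ (1 + β - σ) ≤ 2 * (E.dstar mf D : ℝ) ^ (1 + β - σ) :=
      EndgameData.add_one_rpow_le_two_mul_rpow (by linarith) hd1 hdN₅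
    refine ⟨h1, h3, h2, ?_, ?_⟩
    · calc ((E.pts (E.zt mf D)).card : ℝ) ≤ E.A₁₄ * ((E.dstar mf D : ℝ) + 1) ^ (2 - σ) := h4.1
        _ ≤ E.A₁₄ * (2 * (E.dstar mf D : ℝ) ^ (2 - σ)) := mul_le_mul_of_nonneg_left e1 hA0.le
        _ = 2 * E.A₁₄ * (E.dstar mf D : ℝ) ^ (2 - σ) := by ring
    · calc E.ht (E.zt mf D) ≤ E.B₁₄ * ((E.dstar mf D : ℝ) + 1) ^ (1 + β - σ) := h4.2
        _ ≤ E.B₁₄ * (2 * (E.dstar mf D : ℝ) ^ (1 + β - σ)) := mul_le_mul_of_nonneg_left e2 hB0.le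
        _ = 2 * E.B₁₄ * (E.dstar mf D : ℝ) ^ (1 + β - σ) := by ring
  -- the exponent endgame (stub D), fed at every large level by stubs B and C
  refine stub_exponents (σ := σ) (β := β) (ν := ν) (K₁ := 32 * E.B₁₄ / E.κ) (K₂ := 8 / E.κ)
    (K₃ := E.κ / 8) (by positivity) (by positivity) (by positivity) hσ1 hσ2 hβ hν fun N => ?_
  set D : ℕ := D₂ + N₀ + 1 + ⌈N⌉₊ + Nc + NB with hD_def
  obtain ⟨hN₀d, hdD, hcrit, hdeg, hht⟩ := regime D (by omega)
  obtain ⟨hd0, -, -⟩ := h17' (E.dstar mf D) (by omega)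
  obtain ⟨hD0, -, hP⟩ := h17' D (by omega)
  have hd1 : 1 ≤ E.dstar mf D := by omega
  set d : ℕ := E.dstar mf D with hd_def
  have hdpos : (0 : ℝ) < d := by exact_mod_cast hd1
  have hdr : (1 : ℝ) ≤ d := by exact_mod_cast hd1
  have hDpos : (0 : ℝ) < D := by linarith [show (d : ℝ) ≤ D by exact_mod_cast hdD.le]
  -- stub C at the level `D`, auxiliary level `d`
  have hcore := stub_case2Free E hσ1' hβ hν' hd1 hdD hd0 (hN₂ _ (by omega)) (hN₃ _ (by omega))
    (hN₄ _ (by omega)) hcrit hdeg hht hP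
  -- the degree of `Z̃_D` is that of `Z_D`
  have hcardZ : (E.pts (E.zt mf D)).card = (E.pts (E.Z D)).card := E.card_pts_τV _ _
  set c : ℝ := ((E.pts (E.Z D)).card : ℝ) with hc_def
  have hc1 : (1 : ℝ) ≤ c := E.one_le_card _
  have hcz : ((E.pts (E.zt mf D)).card : ℝ) = c := by rw [hc_def]; exact_mod_cast hcardZ
  -- non-concentration at the level `D`: Corollary 16 + stub B + numerics
  obtain ⟨ι, hι, hsum⟩ := E.cor16 D hD0
  have hnc : ∀ a ∈ E.pts (E.Z D),
      -(E.κ / 2 * (D : ℝ) ^ (ν - β + σ - 2) *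
          (2 * (D : ℝ) ^ β * (E.pts (E.Z D)).card + D * E.ht (E.Z D))) <
        (D : ℝ) ^ β + Real.log (E.dist a (E.γ (ι a))) := by
    intro a ha
    by_contra hle
    push Not at hle
    exact hNc D (by omega) ⟨ι, hι, a, ha, hle⟩
  have hB := stub_degLowerBound E hnoper hι hsum hnc
  have hNC : E.κ / 8 * (D : ℝ) ^ (ν + σ - 1 - β) ≤ c ^ 2 :=
    hNB D (by omega) c (E.ht (E.Z D)) hc1 (E.ht_nonneg _) hB
  -- assemble the three inequalities
  refine ⟨D, ?_, d, hdr, by exact_mod_cast hdD.le, c, by linarith, hNC, ?_, ?_⟩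
  · have : (⌈N⌉₊ : ℝ) ≤ D := by exact_mod_cast (show ⌈N⌉₊ ≤ D by omega)
    exact le_trans (Nat.le_ceil N) this
  · -- (I″): `(κ/16) d^σ D^{ν-2} c ≤ d ht ≤ 2B d^{2+β-σ}`
    have i1 : E.κ / 16 * (d : ℝ) ^ σ * (D : ℝ) ^ (ν - 2) * c ≤ d * E.ht (E.zt mf D) := by
      rw [← hcz]; exact hcore.1
    have i2 : (d : ℝ) * E.ht (E.zt mf D) ≤ 2 * E.B₁₄ * (d : ℝ) ^ (2 + β - σ) := by
      have := mul_le_mul_of_nonneg_left hht hdpos.le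
      have e : (d : ℝ) * (2 * E.B₁₄ * (d : ℝ) ^ (1 + β - σ)) =
          2 * E.B₁₄ * (d : ℝ) ^ (2 + β - σ) := by
        rw [show 2 + β - σ = 1 + (1 + β - σ) by ring, Real.rpow_add hdpos, Real.rpow_one]; ring
      linarith
    have i3 : E.κ / 16 * ((d : ℝ) ^ σ * (D : ℝ) ^ (ν - 2) * c) ≤ 2 * E.B₁₄ * (d : ℝ) ^ (2 + β - σ) := by
      linarith [show E.κ / 16 * ((d : ℝ) ^ σ * (D : ℝ) ^ (ν - 2) * c) =
        E.κ / 16 * (d : ℝ) ^ σ * (D : ℝ) ^ (ν - 2) * c by ring]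
    have hk : 0 < E.κ / 16 := by positivity
    rw [mul_comm, ← le_div_iff₀ hk] at i3
    refine i3.trans (le_of_eq ?_)
    field_simp
    ring
  · exact hcore.2

end AbstractSharp

end Summit.Schanuel.Schanuel.Theorems.NguyenRoySharp

end
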